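import Mathlib.NumberTheory.Chebyshev
import Mathlib.NumberTheory.PrimeCounting
import Mathlib.Analysis.SpecialFunctions.Log.Monotone
import Mathlib.Analysis.Complex.ExponentialBounds
import Literature.NumberTheory.LFunctions.LogIntegral
import Literature.NumberTheory.DiophantineGeometry.NamedHypotheses
import HarnessLib

/-!
# Büthe's partial prime number theorem under RH up to height `T`, and Platt–Trudgian 2021, Cor. 1

Topic: `Literature/NumberTheory/LFunctions`. What a NUMERICAL VERIFICATION OF RH TO HEIGHT `T`
(the tree's named hypothesis `Literature.NumberTheory.DiophantineGeometry.RiemannHypothesisUpTo T`,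
e.g. Platt–Trudgian 2021, `T = 3 000 175 332 800`) BUYS for the primes: Schoenfeld's RH-conditional
explicit bounds for `ψ`, `ϑ`, `π` hold UNCONDITIONALLY in the finite range `4.92 √(x/log x) ≤ T`,
i.e. for `x` up to about `(T/4.92)² log`.

## Source statements (as printed)

* J. Büthe, *Estimating π(x) and related functions under partial RH assumptions*, Math. Comp. **85**
  (2016), no. 301, 2483–2498 (arXiv:1410.7015), §7, **Theorem 2**: "Let `T > 0` such that the Riemann
  hypothesis holds for `0 < Im(ρ) ≤ T`. Then, under the condition `4.92 √(x/log x) ≤ T`, the following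
  estimates hold: `|ψ(x) − x| ≤ (√x/8π) log(x)²` for `x > 59`, `|ϑ(x) − x| ≤ (√x/8π) log(x)²` for
  `x > 599`, `|π*(x) − li(x)| ≤ (√x/8π) log(x)` for `x > 59`, and `|π(x) − li(x)| ≤ (√x/8π) log(x)` for
  `x > 2657`." [corpus: paper:arxiv-1410.7015 p.10] — the named fact `Buthe2016_thm2` below (the
  `π*`-line, about Riemann's `Π(x) = ∑_{p^m ≤ x} 1/m`, is not typed: the tree has no `Π`; see the TODO).
* D. Platt, T. Trudgian, *The Riemann hypothesis is true up to 3·10¹²*, Bull. Lond. Math. Soc. **53**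
  (2021) 792–797, §3.1, **Corollary 1** (from their Thm. 1 and Büthe's theorem): "The following bounds
  hold in the range indicated: `|ψ(x) − x| ≤ (√x/8π) log² x` (`59 < x ≤ 2.169·10²⁵`),
  `|θ − x| ≤ (√x/8π) log² x` (`599 < x ≤ 2.169·10²⁵`), `|π(x) − li(x)| ≤ (√x/8π) log² x`
  (`2657 < x ≤ 2.169·10²⁵`)." [corpus: paper:arxiv-2004.09765 p.4] — the named fact
  `PlattTrudgian2021_cor1` below, typed verbatim (PT print `log² x` in the `π`-line; Büthe's theorem
  gives the sharper `log x`, which the proved corollary below also records).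

## What is proved here (standard axioms, no `sorry`)

* `buthe_range_plattTrudgian` (private helpers `exp_58338_le`, `le_log_xPT`, `div_log_le_div_log`): for
  `59 < x ≤ 2.169·10²⁵` the Büthe condition
  `4.92 √(x/log x) ≤ 3 000 175 332 800` holds (kernel arithmetic: `log x / x` is antitone beyond `e`
  (`Real.log_div_self_antitoneOn`), `log(2.169·10²⁵) ≥ 58.338` from `Real.exp_one_lt_d9` and the Taylor
  bound `Real.exp_bound'`). The endpoint is sharp to three digits (`x_max ≈ 2.1693·10²⁵`).
* `Buthe2016_thm2.plattTrudgian_range`: Büthe's Thm. 2 and RH up to the Platt–Trudgian height give the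
  three bounds on `(59, 2.169·10²⁵]` (with `log x` in the `π`-line), and
  `Buthe2016_thm2.plattTrudgian2021_cor1`: they give `PlattTrudgian2021_cor1` as printed. So PT's
  Cor. 1 is CONDITIONAL exactly on the two named facts `Buthe2016_thm2` (analytic, size L: explicit
  formula with the Logan-type kernel of Büthe's §§3–6) and `RiemannHypothesisUpTo 3000175332800`
  (= `riemannHypothesisUpTo_platt_trudgian` = rh.S35 `platt_trudgian_numerical_rh`, a 7.5·10⁶ core-hour
  computation, not kernel-replayable).

## Vocabulary (all existing)

`ψ = Chebyshev.psi`, `θ = Chebyshev.theta` (Mathlib, scoped notation `Chebyshev`), `π(x) = Nat.primeCounting ⌊x⌋₊`,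
`li = Literature.NumberTheory.LFunctions.logIntegral` (principal value from `0`, as in Schoenfeld and Büthe),
RH to height `T` = `Literature.NumberTheory.DiophantineGeometry.RiemannHypothesisUpTo T`. Compare the
RH-conditional originals `Schoenfeld1976_psi`, `Schoenfeld1976_theta`, `schoenfeld_explicit`
(`SchoenfeldExplicit.lean`, `NicolasMertensRH.lean`, `RHConditionalFacts.lean`).

Deliberately NOT here: Büthe's Thm. 1 (the flexible `|ψ(x) − x| ≤ δ₀ x` machine with parameters
`ε, c, x₀, α`), the `π*`-line, and any discharge of `Buthe2016_thm2`.
-/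

noncomputable section

open Real
open scoped Chebyshev

namespace Literature.NumberTheory.LFunctions

open Literature.NumberTheory.DiophantineGeometry

/-! ### The named facts -/

/-- NAMED FACT (Büthe 2016, §7, Theorem 2, as printed): "Let `T > 0` such that the Riemann hypothesis
holds for `0 < Im(ρ) ≤ T`. Then, under the condition `4.92 √(x/log x) ≤ T`, the following estimates hold:
`|ψ(x) − x| ≤ (√x/8π) log(x)²` for `x > 59`, `|ϑ(x) − x| ≤ (√x/8π) log(x)²` for `x > 599`, […]
`|π(x) − li(x)| ≤ (√x/8π) log(x)` for `x > 2657`." The hypothesis "RH for `0 < Im ρ ≤ T`" is the tree's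
`RiemannHypothesisUpTo T`; `ψ, ϑ` are Mathlib's Chebyshev functions, `π(x) = Nat.primeCounting ⌊x⌋₊`,
`li = logIntegral`. Users take `(h : Buthe2016_thm2)`. Not discharged (explicit-formula analysis with
Büthe's compactly supported Logan kernels, §§3–6 of the source).
-- TODO(general form): the third printed line `|π*(x) − li(x)| ≤ (√x/8π) log x` for `x > 59`, with
-- Riemann's `π*(x) = ∑_{p^m ≤ x} 1/m`, is omitted (no `π*` in the tree).
[cite: Buthe2016, Thm. 2 (§7, p. 2493)] -/
def Buthe2016_thm2 : Prop :=
  ∀ T : ℝ, 0 < T → RiemannHypothesisUpTo T →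
    ∀ x : ℝ, 4.92 * Real.sqrt (x / Real.log x) ≤ T →
      (59 < x → |ψ x - x| ≤ Real.sqrt x / (8 * π) * Real.log x ^ 2) ∧
      (599 < x → |θ x - x| ≤ Real.sqrt x / (8 * π) * Real.log x ^ 2) ∧
      (2657 < x → |(Nat.primeCounting ⌊x⌋₊ : ℝ) - logIntegral x| ≤ Real.sqrt x / (8 * π) * Real.log x)

/-- NAMED FACT (Platt–Trudgian 2021, §3.1, Corollary 1, as printed): "The following bounds hold in the
range indicated: `|ψ(x) − x| ≤ (√x/8π) log² x` (`59 < x ≤ 2.169·10²⁵`), `|θ − x| ≤ (√x/8π) log² x`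
(`599 < x ≤ 2.169·10²⁵`), `|π(x) − li(x)| ≤ (√x/8π) log² x` (`2657 < x ≤ 2.169·10²⁵`)." In print it is
Büthe's Theorem 2 combined with their Theorem 1 (RH to height `3 000 175 332 800`); see
`Buthe2016_thm2.plattTrudgian2021_cor1` for exactly that derivation in the kernel (the `π`-line even with
`log x`). Users take `(h : PlattTrudgian2021_cor1)`. [cite: PlattTrudgianBLMS2021, Cor. 1 (§3.1, p. 795)] -/
def PlattTrudgian2021_cor1 : Prop :=
  ∀ x : ℝ, x ≤ 2.169e25 →
    (59 < x → |ψ x - x| ≤ Real.sqrt x / (8 * π) * Real.log x ^ 2) ∧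
    (599 < x → |θ x - x| ≤ Real.sqrt x / (8 * π) * Real.log x ^ 2) ∧
    (2657 < x → |(Nat.primeCounting ⌊x⌋₊ : ℝ) - logIntegral x| ≤ Real.sqrt x / (8 * π) * Real.log x ^ 2)

/-! ### The Platt–Trudgian range satisfies Büthe's condition (kernel arithmetic) -/

/-- `exp 58.338 ≤ 2.169·10²⁵`: `exp 58.338 = (exp 1)⁵⁸ · exp 0.338`, with `exp 1 < 2.7182818286`
(`Real.exp_one_lt_d9`) and the Taylor bound `Real.exp_bound'` (five terms) for `exp 0.338`. [folklore] -/
private theorem exp_58338_le : Real.exp 58.338 ≤ 2.169e25 := by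
  have h1 : Real.exp 58.338 = Real.exp 1 ^ 58 * Real.exp 0.338 := by
    rw [Real.exp_one_pow, ← Real.exp_add]; congr 1; norm_num
  have h2 : Real.exp 1 ^ 58 ≤ (2.7182818286 : ℝ) ^ 58 :=
    pow_le_pow_left₀ (Real.exp_pos 1).le Real.exp_one_lt_d9.le 58
  have h3 : Real.exp 0.338 ≤ 1.40215 := by
    have h := Real.exp_bound' (x := (0.338 : ℝ)) (by norm_num) (by norm_num) (n := 5) (by norm_num)
    refine h.trans ?_
    simp only [Finset.sum_range_succ, Finset.sum_range_zero, Nat.factorial]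
    norm_num
  rw [h1]
  calc Real.exp 1 ^ 58 * Real.exp 0.338 ≤ (2.7182818286 : ℝ) ^ 58 * 1.40215 :=
        mul_le_mul h2 h3 (Real.exp_pos _).le (by positivity)
    _ ≤ 2.169e25 := by norm_num

/-- `58.338 ≤ log(2.169·10²⁵)` (true value `58.3389…`). [folklore] -/
private theorem le_log_xPT : (58.338 : ℝ) ≤ Real.log 2.169e25 :=
  (Real.le_log_iff_exp_le (by norm_num)).2 exp_58338_le

/-- For `e ≤ x ≤ x₀`: `x / log x ≤ x₀ / log x₀` (`log x / x` is antitone on `[e, ∞)`,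
`Real.log_div_self_antitoneOn`). [folklore] -/
private theorem div_log_le_div_log {x x₀ : ℝ} (hx : Real.exp 1 ≤ x) (hxx₀ : x ≤ x₀) :
    x / Real.log x ≤ x₀ / Real.log x₀ := by
  have hx0 : 0 < x := (Real.exp_pos 1).trans_le hx
  have hx₀0 : 0 < x₀ := hx0.trans_le hxx₀
  have hlogx : 0 < Real.log x := Real.log_pos ((lt_trans (by norm_num) Real.exp_one_gt_d9).trans_le hx)
  have hlogx₀ : 0 < Real.log x₀ :=
    Real.log_pos (((lt_trans (by norm_num) Real.exp_one_gt_d9).trans_le hx).trans_le hxx₀)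
  have hanti := Real.log_div_self_antitoneOn (Set.mem_Ici.2 hx) (Set.mem_Ici.2 (hx.trans hxx₀)) hxx₀
  -- `hanti : log x₀ / x₀ ≤ log x / x`
  rw [div_le_div_iff₀ hlogx hlogx₀]
  have := (div_le_div_iff₀ hx₀0 hx0).1 hanti
  linarith

/-- **The Platt–Trudgian range satisfies Büthe's condition**: for `59 < x ≤ 2.169·10²⁵`,
`4.92 √(x/log x) ≤ 3 000 175 332 800` (the endpoint is sharp to three digits: equality near
`x ≈ 2.1693·10²⁵`). [cite: PlattTrudgianBLMS2021, Cor. 1 (§3.1: "for those x such that 4.92 √(x/log x) ≤ H")] -/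
theorem buthe_range_plattTrudgian {x : ℝ} (h59 : 59 < x) (hx : x ≤ 2.169e25) :
    4.92 * Real.sqrt (x / Real.log x) ≤ 3000175332800 := by
  have he : Real.exp 1 ≤ x := (Real.exp_one_lt_d9.trans (by norm_num)).le.trans h59.le
  have h1 : x / Real.log x ≤ 2.169e25 / Real.log 2.169e25 := div_log_le_div_log he hx
  have h2 : (2.169e25 : ℝ) / Real.log 2.169e25 ≤ 2.169e25 / 58.338 :=
    div_le_div_of_nonneg_left (by norm_num) (by norm_num) le_log_xPT
  have h3 : x / Real.log x ≤ (3000175332800 / 4.92) ^ 2 :=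
    (h1.trans h2).trans (by norm_num)
  have h4 : Real.sqrt (x / Real.log x) ≤ 3000175332800 / 4.92 := by
    rw [← Real.sqrt_sq (show (0 : ℝ) ≤ 3000175332800 / 4.92 by norm_num)]
    exact Real.sqrt_le_sqrt h3
  linarith

/-! ### Consequences: Platt–Trudgian's Cor. 1 from Büthe's theorem and RH to height `3·10¹²` -/

namespace Buthe2016_thm2

/-- Büthe's Thm. 2 with the Platt–Trudgian height: RH up to `3 000 175 332 800` gives Schoenfeld's bounds
for `ψ, ϑ` (`log² x`) and `π − li` (`log x`) on `59 < x ≤ 2.169·10²⁵` (resp. from `599`, `2657`).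
CONDITIONAL on the two named facts taken as hypotheses. [cite: Buthe2016, Thm. 2; PlattTrudgianBLMS2021, Cor. 1] -/
theorem plattTrudgian_range (h : Buthe2016_thm2) (hRH : RiemannHypothesisUpTo 3000175332800)
    {x : ℝ} (h59 : 59 < x) (hx : x ≤ 2.169e25) :
    |ψ x - x| ≤ Real.sqrt x / (8 * π) * Real.log x ^ 2 ∧
      (599 < x → |θ x - x| ≤ Real.sqrt x / (8 * π) * Real.log x ^ 2) ∧
      (2657 < x → |(Nat.primeCounting ⌊x⌋₊ : ℝ) - logIntegral x| ≤ Real.sqrt x / (8 * π) * Real.log x) := by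
  have H := h 3000175332800 (by norm_num) hRH x (buthe_range_plattTrudgian h59 hx)
  exact ⟨H.1 h59, H.2.1, H.2.2⟩

/-- **Platt–Trudgian 2021, Cor. 1, as printed, from its two inputs**: Büthe's Thm. 2 and RH up to height
`3 000 175 332 800` (their Thm. 1). The printed `π`-line has `log² x ≥ log x` (`log x ≥ 1` for `x > 2657`).
[cite: PlattTrudgianBLMS2021, Cor. 1; Buthe2016, Thm. 2] -/
theorem plattTrudgian2021_cor1 (h : Buthe2016_thm2) (hRH : RiemannHypothesisUpTo 3000175332800) :
    PlattTrudgian2021_cor1 := by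
  intro x hx
  refine ⟨fun h59 ↦ (plattTrudgian_range h hRH h59 hx).1,
    fun h599 ↦ (plattTrudgian_range h hRH (by linarith) hx).2.1 h599, fun h2657 ↦ ?_⟩
  have hπ := (plattTrudgian_range h hRH (by linarith) hx).2.2 h2657
  refine hπ.trans ?_
  have hlog : 1 ≤ Real.log x := by
    rw [← Real.log_exp 1]
    exact Real.log_le_log (Real.exp_pos 1) ((Real.exp_one_lt_d9.trans (by norm_num)).le.trans h2657.le)
  have hnn : 0 ≤ Real.sqrt x / (8 * π) := by positivity
  calc Real.sqrt x / (8 * π) * Real.log x = Real.sqrt x / (8 * π) * (Real.log x * 1) := by ring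
    _ ≤ Real.sqrt x / (8 * π) * (Real.log x * Real.log x) :=
        mul_le_mul_of_nonneg_left (mul_le_mul_of_nonneg_left hlog (by linarith)) hnn
    _ = Real.sqrt x / (8 * π) * Real.log x ^ 2 := by ring

end Buthe2016_thm2

end Literature.NumberTheory.LFunctions

end
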